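import Literature.NumberTheory.Automorphic.UnitaryGroupTorusSiegelSetTwo
import Literature.NumberTheory.Automorphic.UnitaryGroupTorusThreeRay
import HarnessLib

/-!
# The diagonal ray and the coordinate compacta of the adelic torus of `U(J₂)`; the «compact · ray» Siegel data and the
# height window at `N = 2` (H-side brick H-B4, FILE B)

Topic `NumberTheory/Automorphic`; namespace `Literature.NumberTheory.Automorphic.UnitaryGroup`.  THEOREMS ONLY (no definition, no
named fact, no instance, no notation, no `sorry`).  Sequel of ★ `UnitaryGroupTorusSiegelSetTwo` (FILE A: the torus Siegel set of `U(J₂)`,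
one ray) and the `N = 2` sibling of ★ `UnitaryGroupTorusThreeRay` ∕ ★ `UnitaryGroupTorusSiegelData` ∕ ★ `UnitaryGroupTorusSiegelHeightWindow`
for the H-side copy of LAWS 1–5 of the T1 engine `Cruxes/H413/Lines/F0_T1InnerFormTraceIdentity.lean` (cell `pub/hodgecm-mathlib`, crux
H413; census `CENSUS-LAWS-Hside.F0P3a-p03g6.md` §4 H-B4).  HC_CM is proved only modulo the printed citations until rung 0 closes.

The torus of `U(J₂)` is `T(𝔸_F) = {diag(a, (c a)⁻¹) : a ∈ 𝕀_E}` (FILE A `diagUnit_one_two`): ONE idelic coordinate `d₀`.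

* §1 **`exists_torus_diagUnit_eq_two`** (a torus element with prescribed `d₀ = a`, any `a ∈ 𝕀_E`),
  `adelicVal_torus_eq_glDiagonal_diagUnit_two`, **`eq_of_diagUnit_zero_eq_two`** (`t` is determined by `d₀ t`),
  `continuous_diagUnit_torus_two`;
* §2 **`isCompact_setOf_diagUnit_zero_mem_two`** — `{t ∈ T(𝔸_F) | d₀ t ∈ C}` is compact for compact `C ⊆ 𝕀_E` (continuous image of `C`
  under the chart `a ↦ diag(a, (c a)⁻¹)`);
* §3 **`exists_torusRay_two`** — the diagonal ray `ρ(s) = diag(z_E(e^s), z_E(e^s)⁻¹)` (`z_E = posRealIdele E`, `c`-fixed): continuous,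
  additive, `d₀(ρ s) = z_E(e^s)`, HEIGHT LAW `H(ρ(s) t) = e^{[E:ℚ] s} H(t)` (★ `borelHeight_torus_mul'`, any `N`);
* §4 **`exists_torusSiegelData_two`** — the «compact · ray» packaging `S ⊆ range ρ · 𝔎`, `T(𝔸_F) = T(F) · S` consumed by ★
  `setLIntegral_rpow_neg_borelHeight_lt_top` (any `N`): the `N = 2` sibling of ★ `exists_torusSiegelData`;
* §5 **`isCompact_torusSiegel_heightWindow_two`** — the height window `{t ∈ S_T | H₀ ≤ H(t) ≤ R}` is compact (the `N = 2` sibling of ★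
  `isCompact_torusSiegel_heightWindow`), `measure_torusSiegel_heightWindow_two_lt_top`.

## References
* J. D. Rogawski, *Automorphic Representations of Unitary Groups in Three Variables* (1990), §1.10, §2.2 (p. 13), p. 98 [Rogawski1990].
* J. Arthur, *A trace formula for reductive groups I*, Duke Math. J. 45 (1978), §8 [Arthur1978TraceFormulaI].
* A. Borel, *Some finiteness properties of adele groups over number fields*, Publ. Math. IHÉS 16 (1963), §5 [Borel1963].
-/

set_option autoImplicit false

noncomputable section

open MeasureTheory Measure Set NumberField IsDedekindDomain Topology
open scoped NNReal ENNReal Pointwise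

namespace Literature.NumberTheory.Automorphic

namespace UnitaryGroup

variable {F E : Type} [Field F] [NumberField F] [Field E] [NumberField E] [Algebra F E] {c : E ≃ₐ[F] E}

/-! ## §1 Torus elements of `U(J₂)` from the coordinate `d₀` -/

section Coordinates

omit [NumberField F] in
/-- The torus relations `c(d_{rev i}) d_i = 1` hold for the diagonal vector `(a, (c a)⁻¹)` when `c² = 1`. [cite: Rogawski1990, §1.10] -/
theorem conjAdele_vec2_rev_mul (hc : c * c = 1) (a : (AdeleRing (𝓞 E) E)ˣ) (i : Fin 2) :
    conjAdele F E c
        ((![a, (Units.map (conjAdele F E c : AdeleRing (𝓞 E) E →* AdeleRing (𝓞 E) E) a)⁻¹] (Fin.rev i) :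
          (AdeleRing (𝓞 E) E)ˣ) : AdeleRing (𝓞 E) E) *
        ((![a, (Units.map (conjAdele F E c : AdeleRing (𝓞 E) E →* AdeleRing (𝓞 E) E) a)⁻¹] i :
          (AdeleRing (𝓞 E) E)ˣ) : AdeleRing (𝓞 E) E) = 1 := by
  fin_cases i
  · show conjAdele F E c (((Units.map (conjAdele F E c : AdeleRing (𝓞 E) E →* AdeleRing (𝓞 E) E) a)⁻¹ :
        (AdeleRing (𝓞 E) E)ˣ) : AdeleRing (𝓞 E) E) * (a : AdeleRing (𝓞 E) E) = 1
    rw [Units.coe_map_inv, MonoidHom.coe_coe, conjAdele_conjAdele hc, Units.inv_mul]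
  · show conjAdele F E c (a : AdeleRing (𝓞 E) E) *
        (((Units.map (conjAdele F E c : AdeleRing (𝓞 E) E →* AdeleRing (𝓞 E) E) a)⁻¹ : (AdeleRing (𝓞 E) E)ˣ) :
          AdeleRing (𝓞 E) E) = 1
    rw [Units.coe_map_inv, MonoidHom.coe_coe, ← map_mul, Units.mul_inv, map_one]

omit [NumberField F] in
/-- `diag(a, (c a)⁻¹) ∈ U(J₂)(𝔸_F)`. [cite: Rogawski1990, §1.10] -/
theorem glDiagonal_vec2_mem_adelic (hc : c * c = 1) (a : (AdeleRing (𝓞 E) E)ˣ) :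
    glDiagonal 2 (AdeleRing (𝓞 E) E) ![a, (Units.map (conjAdele F E c : AdeleRing (𝓞 E) E →* AdeleRing (𝓞 E) E) a)⁻¹] ∈
      adelic F E c 2 ((StdForm.antidiagonal 2).over E) := by
  change glDiagonal 2 (AdeleRing (𝓞 E) E) _ ∈
    unitaryGroupOfForm (conjAdele F E c) (adelicForm E 2 ((StdForm.antidiagonal 2).over E))
  rw [adelicForm_antidiagonal]
  exact (glDiagonal_mem_unitaryGroupOfForm_antidiagonal_iff _ 2 _).2 (conjAdele_vec2_rev_mul hc a)

/-- **Torus elements of `U(J₂)` from the coordinate**: for every `a ∈ 𝕀_E` there is `t ∈ T(𝔸_F) ≤ B(𝔸_F)` with matrix `diag(a, (c a)⁻¹)`,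
in particular `d₀(t) = a`. [cite: Rogawski1990, §1.10] -/
theorem exists_torus_diagUnit_eq_two (hc : c * c = 1) (a : (AdeleRing (𝓞 E) E)ˣ) :
    ∃ t : torusInBorel F E c 2,
      adelicVal F E c 2 _ ((t : borelAdelic F E c 2) : (quasiSplit F E c 2).Adelic) =
          glDiagonal 2 (AdeleRing (𝓞 E) E) ![a, (Units.map (conjAdele F E c : AdeleRing (𝓞 E) E →* AdeleRing (𝓞 E) E) a)⁻¹] ∧
        diagUnit (t : borelAdelic F E c 2).2 0 = a := by
  set d : Fin 2 → (AdeleRing (𝓞 E) E)ˣ := ![a, (Units.map (conjAdele F E c : AdeleRing (𝓞 E) E →* AdeleRing (𝓞 E) E) a)⁻¹]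
    with hd
  let gA : (quasiSplit F E c 2).Adelic := ⟨glDiagonal 2 (AdeleRing (𝓞 E) E) d, glDiagonal_vec2_mem_adelic hc a⟩
  have hgT : gA ∈ torusAdelic F E c 2 := ⟨d, rfl⟩
  have hgB : gA ∈ borelAdelic F E c 2 := torusAdelic_le_borelAdelic hgT
  refine ⟨⟨⟨gA, hgB⟩, hgT⟩, rfl, ?_⟩
  ext
  rw [coe_diagUnit]
  show (glDiagonal 2 (AdeleRing (𝓞 E) E) d : Matrix (Fin 2) (Fin 2) (AdeleRing (𝓞 E) E)) 0 0 = a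
  rw [coe_glDiagonal, Matrix.diagonal_apply_eq]
  rfl

/-- The diagonal entries of a torus element of `U(J₂)` as a matrix identity: `adelicVal t = diag(d₀ t, d₁ t)`. [cite: Rogawski1990, §1.10] -/
theorem adelicVal_torus_eq_glDiagonal_diagUnit_two (t : torusInBorel F E c 2) :
    adelicVal F E c 2 _ ((t : borelAdelic F E c 2) : (quasiSplit F E c 2).Adelic) =
      glDiagonal 2 (AdeleRing (𝓞 E) E) (diagUnit (t : borelAdelic F E c 2).2) :=
  adelicVal_eq_glDiagonal_diagUnit ((mem_torusInBorel_iff_torusPart_eq _).1 t.2)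

/-- **A torus element of `U(J₂)` is determined by `d₀`** (`d₁ = (c d₀)⁻¹`, FILE A `diagUnit_one_two`). [cite: Rogawski1990, §1.10] -/
theorem eq_of_diagUnit_zero_eq_two {t t' : torusInBorel F E c 2}
    (h0 : diagUnit (t : borelAdelic F E c 2).2 0 = diagUnit (t' : borelAdelic F E c 2).2 0) : t = t' := by
  have h1 : diagUnit (t : borelAdelic F E c 2).2 1 = diagUnit (t' : borelAdelic F E c 2).2 1 := by
    rw [diagUnit_one_two ((mem_torusInBorel_iff_torusPart_eq _).1 t.2),
      diagUnit_one_two ((mem_torusInBorel_iff_torusPart_eq _).1 t'.2), h0]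
  have hfun : diagUnit (t : borelAdelic F E c 2).2 = diagUnit (t' : borelAdelic F E c 2).2 := by
    funext i
    fin_cases i
    · exact h0
    · exact h1
  have hval : adelicVal F E c 2 _ ((t : borelAdelic F E c 2) : (quasiSplit F E c 2).Adelic) =
      adelicVal F E c 2 _ ((t' : borelAdelic F E c 2) : (quasiSplit F E c 2).Adelic) := by
    rw [adelicVal_torus_eq_glDiagonal_diagUnit_two, adelicVal_torus_eq_glDiagonal_diagUnit_two, hfun]
  exact Subtype.ext (Subtype.ext (adelicVal_injective F E c 2 _ hval))

/-- The coordinate `t ↦ d_i(t) ∈ 𝕀_E` is continuous on `T(𝔸_F)` of `U(J₂)` (entries of `t` and `t⁻¹`). [cite: Rogawski1990, §1.10] -/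
theorem continuous_diagUnit_torus_two (i : Fin 2) :
    Continuous fun t : torusInBorel F E c 2 => diagUnit (t : borelAdelic F E c 2).2 i := by
  have hmat : Continuous fun g : (quasiSplit F E c 2).Adelic =>
      (adelicVal F E c 2 _ g : Matrix (Fin 2) (Fin 2) (AdeleRing (𝓞 E) E)) :=
    Units.continuous_val.comp continuous_subtype_val
  refine Units.continuous_iff.2 ⟨?_, ?_⟩
  · exact ((hmat.comp continuous_subtype_val).matrix_elem i i).comp continuous_subtype_val
  · change Continuous fun t : torusInBorel F E c 2 =>
      (adelicVal F E c 2 _ (((t : borelAdelic F E c 2) : (quasiSplit F E c 2).Adelic)⁻¹) :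
        Matrix (Fin 2) (Fin 2) (AdeleRing (𝓞 E) E)) i i
    exact ((hmat.comp continuous_subtype_val.inv).matrix_elem i i).comp continuous_subtype_val

/-- **The chart `a ↦ diag(a, (c a)⁻¹)` of `T(𝔸_F)`**: a continuous map `τ : 𝕀_E → T(𝔸_F)` with `d₀(τ a) = a` (hence a homeomorphism onto
`T(𝔸_F)` by `eq_of_diagUnit_zero_eq_two` and `continuous_diagUnit_torus_two`). [cite: Rogawski1990, §1.10] -/
theorem exists_continuous_torusChart_two (hc : c * c = 1) :
    ∃ τ : (AdeleRing (𝓞 E) E)ˣ → torusInBorel F E c 2, Continuous τ ∧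
      ∀ a, diagUnit ((τ a : torusInBorel F E c 2) : borelAdelic F E c 2).2 0 = a := by
  let dv : (AdeleRing (𝓞 E) E)ˣ → Fin 2 → (AdeleRing (𝓞 E) E)ˣ := fun a =>
    ![a, (Units.map (conjAdele F E c : AdeleRing (𝓞 E) E →* AdeleRing (𝓞 E) E) a)⁻¹]
  have hdv : Continuous dv := by
    refine continuous_pi fun i => ?_
    fin_cases i
    · exact continuous_id
    · exact ((continuous_conjAdele F E c).units_map.comp continuous_id).inv
  have hmemA : ∀ a, glDiagonal 2 (AdeleRing (𝓞 E) E) (dv a) ∈ adelic F E c 2 ((StdForm.antidiagonal 2).over E) :=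
    fun a => glDiagonal_vec2_mem_adelic hc a
  let τA : (AdeleRing (𝓞 E) E)ˣ → (quasiSplit F E c 2).Adelic := fun a => ⟨glDiagonal 2 (AdeleRing (𝓞 E) E) (dv a), hmemA a⟩
  have hτA : Continuous τA := ((continuous_glDiagonal (n := 2) (AdeleRing (𝓞 E) E)).comp hdv).subtype_mk _
  have hmemT : ∀ a, τA a ∈ torusAdelic F E c 2 := fun a => ⟨dv a, rfl⟩
  have hmemB : ∀ a, τA a ∈ borelAdelic F E c 2 := fun a => torusAdelic_le_borelAdelic (hmemT a)
  refine ⟨fun a => ⟨⟨τA a, hmemB a⟩, hmemT a⟩, (hτA.subtype_mk _).subtype_mk _, fun a => ?_⟩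
  ext
  rw [coe_diagUnit]
  show (glDiagonal 2 (AdeleRing (𝓞 E) E) (dv a) : Matrix (Fin 2) (Fin 2) (AdeleRing (𝓞 E) E)) 0 0 = _
  rw [coe_glDiagonal, Matrix.diagonal_apply_eq]
  rfl

end Coordinates

/-! ## §2 Coordinate compacta of the torus of `U(J₂)` -/

/-- **`{t ∈ T(𝔸_F) | d₀ t ∈ C}` is compact** for compact `C ⊆ 𝕀_E`: it is the image of `C` under the chart `a ↦ diag(a, (c a)⁻¹)` (§1).
[cite: Rogawski1990, §1.10] [cite: Borel1963, §5] -/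
theorem isCompact_setOf_diagUnit_zero_mem_two (hc : c * c = 1) {C : Set (AdeleRing (𝓞 E) E)ˣ} (hC : IsCompact C) :
    IsCompact {t : torusInBorel F E c 2 | diagUnit (t : borelAdelic F E c 2).2 0 ∈ C} := by
  haveI := t2Space_ideleGroup E
  obtain ⟨τ, hτ, hd0⟩ := exists_continuous_torusChart_two (F := F) (E := E) (c := c) hc
  refine (hC.image hτ).of_isClosed_subset (hC.isClosed.preimage (continuous_diagUnit_torus_two 0)) ?_
  intro t ht
  exact ⟨diagUnit (t : borelAdelic F E c 2).2 0, ht, eq_of_diagUnit_zero_eq_two (hd0 _)⟩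

/-! ## §3 The diagonal ray `ρ(s) = diag(z_E(e^s), z_E(e^s)⁻¹)` and its height law -/

omit [NumberField F] in
/-- `e^{a+b} = e^a e^b` in `ℝ≥0ˣ`. [folklore] -/
private theorem expUnitNNReal_add₂ (a b : ℝ) : expUnitNNReal (a + b) = expUnitNNReal a * expUnitNNReal b := by
  apply Units.ext; apply NNReal.eq
  rw [Units.val_mul, NNReal.coe_mul, coe_expUnitNNReal, coe_expUnitNNReal, coe_expUnitNNReal]
  exact Real.exp_add a b

/-- **THE DIAGONAL RAY OF `T(𝔸_F) ≤ U(J₂)`.**  There is a continuous one-parameter family `ρ : ℝ → T(𝔸_F)`, `ρ(a + b) = ρ(a) ρ(b)`,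
with coordinate `d₀(ρ s) = z_E(e^s)` (the positive real scalar idele), along which the Borel height is HOMOGENEOUS:
`H(ρ(s) t) = e^{[E:ℚ] s} · H(t)` (`H(d(a,·) g) = ‖a‖_{𝔸_E} H(g)`, `‖z_E(r)‖ = r^{[E:ℚ]}`). [cite: Rogawski1990, §2.2] [cite: Borel1963, §5]
[cite: Arthur1978TraceFormulaI, §8 (pp. 947–950)] -/
theorem exists_torusRay_two (hc : c * c = 1) :
    ∃ ρ : ℝ → torusInBorel F E c 2, Continuous ρ ∧ (∀ a b, ρ (a + b) = ρ a * ρ b) ∧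
      (∀ s, diagUnit ((ρ s : torusInBorel F E c 2) : borelAdelic F E c 2).2 0 = posRealIdele E (expUnitNNReal s)) ∧
      ∀ (s : ℝ) (t : torusInBorel F E c 2),
        (borelHeight (((ρ s * t : torusInBorel F E c 2) : borelAdelic F E c 2) : (quasiSplit F E c 2).Adelic) : ℝ) =
          Real.exp (Module.finrank ℚ E * s) *
            borelHeight (((t : torusInBorel F E c 2) : borelAdelic F E c 2) : (quasiSplit F E c 2).Adelic) := by
  obtain ⟨τ, hτ, hd0⟩ := exists_continuous_torusChart_two (F := F) (E := E) (c := c) hc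
  have hz : Continuous fun s : ℝ => posRealIdele E (expUnitNNReal s) :=
    (continuous_posRealIdele E).comp continuous_expUnitNNReal
  let ρ : ℝ → torusInBorel F E c 2 := fun s => τ (posRealIdele E (expUnitNNReal s))
  have hρd : ∀ s, diagUnit ((ρ s : torusInBorel F E c 2) : borelAdelic F E c 2).2 0 = posRealIdele E (expUnitNNReal s) :=
    fun s => hd0 _
  refine ⟨ρ, hτ.comp hz, fun a b => ?_, hρd, fun s t => ?_⟩
  · -- additivity: both sides are torus elements with the same `d₀`
    refine eq_of_diagUnit_zero_eq_two ?_
    have ha := adelicVal_torus_eq_glDiagonal_diagUnit_two (ρ a)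
    have hb := adelicVal_torus_eq_glDiagonal_diagUnit_two (ρ b)
    refine Units.ext ?_
    rw [hρd, expUnitNNReal_add₂, map_mul, Units.val_mul, ← hρd a, ← hρd b, coe_diagUnit, coe_diagUnit, coe_diagUnit]
    symm
    -- read the `(0,0)` entry of `diag(d(ρa ρb)) = diag(d(ρa)) diag(d(ρb))`
    change (adelicVal F E c 2 _ ((((ρ a : torusInBorel F E c 2) : borelAdelic F E c 2) : (quasiSplit F E c 2).Adelic) *
        (((ρ b : torusInBorel F E c 2) : borelAdelic F E c 2) : (quasiSplit F E c 2).Adelic)) :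
          Matrix (Fin 2) (Fin 2) (AdeleRing (𝓞 E) E)) 0 0 = _
    rw [map_mul, Units.val_mul, ha, hb, coe_glDiagonal, coe_glDiagonal, Matrix.diagonal_mul_diagonal, Matrix.diagonal_apply_eq,
      Matrix.diagonal_apply_eq, Matrix.diagonal_apply_eq]
  · -- height law
    have hd : glDiagonal 2 (AdeleRing (𝓞 E) E) (diagUnit ((ρ s : torusInBorel F E c 2) : borelAdelic F E c 2).2) =
        adelicVal F E c 2 _ (((ρ s : torusInBorel F E c 2) : borelAdelic F E c 2) : (quasiSplit F E c 2).Adelic) :=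
      (adelicVal_torus_eq_glDiagonal_diagUnit_two (ρ s)).symm
    have hmul : (((ρ s * t : torusInBorel F E c 2) : borelAdelic F E c 2) : (quasiSplit F E c 2).Adelic) =
        (((ρ s : torusInBorel F E c 2) : borelAdelic F E c 2) : (quasiSplit F E c 2).Adelic) *
          (((t : torusInBorel F E c 2) : borelAdelic F E c 2) : (quasiSplit F E c 2).Adelic) := rfl
    rw [hmul, borelHeight_torus_mul' hd, NNReal.coe_mul, hρd]
    congr 1
    rw [ideleNorm_posRealIdele_holds E (expUnitNNReal s), NNReal.coe_pow, coe_expUnitNNReal, ← Real.exp_nat_mul]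

/-! ## §4 The «compact · ray» Siegel data of `T(𝔸_F) ≤ U(J₂)` -/

/-- **THE TORUS SIEGEL DATA OF `U(J₂)`** (the `N = 2` sibling of ★ `exists_torusSiegelData`): a measurable `S ⊆ T(𝔸_F)`, a compact `𝔎` and
the ray `ρ` with `S ⊆ range ρ · 𝔎`, the height law, and `T(𝔸_F) = T(F) · S` — exactly the hypotheses of the ray integral ★
`setLIntegral_rpow_neg_borelHeight_lt_top` (any `N`). [cite: Rogawski1990, §2.2 (p. 13)] [cite: Arthur1978TraceFormulaI, §8 (pp. 947–950)] -/
theorem exists_torusSiegelData_two [MeasurableSpace (torusInBorel F E c 2)] [BorelSpace (torusInBorel F E c 2)]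
    (h2 : Module.finrank F E = 2) (hc : c * c = 1) (hc1 : c ≠ 1) :
    ∃ (S 𝔎 : Set (torusInBorel F E c 2)) (ρ : ℝ → torusInBorel F E c 2),
      MeasurableSet S ∧ IsCompact 𝔎 ∧ Continuous ρ ∧ 0 < (Module.finrank ℚ E : ℝ) ∧
      (∀ (s : ℝ) (t : torusInBorel F E c 2),
        (borelHeight (((ρ s * t : torusInBorel F E c 2) : borelAdelic F E c 2) : (quasiSplit F E c 2).Adelic) : ℝ) =
          Real.exp ((Module.finrank ℚ E : ℝ) * s) *
            borelHeight (((t : torusInBorel F E c 2) : borelAdelic F E c 2) : (quasiSplit F E c 2).Adelic)) ∧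
      S ⊆ Set.range ρ * 𝔎 ∧
      ∀ t : torusInBorel F E c 2,
        ∃ τ : (rationalBorel F E c 2).subgroupOf (torusInBorel F E c 2), τ • t ∈ S := by
  obtain ⟨S_T, W, hclosed, hW, hSTt, hexp, hcov, -, -⟩ := exists_torusSiegelSet_two F E c h2 hc1
  obtain ⟨ρ, hρc, -, hρd, hρH⟩ := exists_torusRay_two (F := F) (E := E) (c := c) hc
  refine ⟨((↑) : torusInBorel F E c 2 → borelAdelic F E c 2) ⁻¹' S_T,
    {k : torusInBorel F E c 2 | diagUnit (k : borelAdelic F E c 2).2 0 ∈ W},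
    ρ, (hclosed.preimage continuous_subtype_val).measurableSet, isCompact_setOf_diagUnit_zero_mem_two hc hW, hρc,
    Nat.cast_pos.2 Module.finrank_pos, hρH, ?_, ?_⟩
  · -- `S ⊆ range ρ · 𝔎`
    intro t ht
    obtain ⟨w, hw, s, h0, -, -⟩ := hexp (t : borelAdelic F E c 2) ht
    refine Set.mem_mul.2 ⟨ρ s, Set.mem_range_self s, (ρ s)⁻¹ * t, ?_, mul_inv_cancel_left _ _⟩
    show diagUnit ((((ρ s)⁻¹ * t : torusInBorel F E c 2) : borelAdelic F E c 2)).2 0 ∈ W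
    have hmul : (((ρ s)⁻¹ * t : torusInBorel F E c 2) : borelAdelic F E c 2) =
        ((ρ s : torusInBorel F E c 2) : borelAdelic F E c 2)⁻¹ * (t : borelAdelic F E c 2) := rfl
    -- `d₀((ρ s)⁻¹ t) = z(e^s)⁻¹ · d₀ t = w`
    have hρs : torusPart ((ρ s : torusInBorel F E c 2) : borelAdelic F E c 2) = (ρ s : torusInBorel F E c 2) :=
      (mem_torusInBorel_iff_torusPart_eq _).1 (ρ s).2
    have hinv : torusPart (((ρ s : torusInBorel F E c 2) : borelAdelic F E c 2)⁻¹) =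
        ((ρ s : torusInBorel F E c 2) : borelAdelic F E c 2)⁻¹ :=
      (mem_torusInBorel_iff_torusPart_eq _).1 ((ρ s)⁻¹).2
    have hd : diagUnit ((((ρ s : torusInBorel F E c 2) : borelAdelic F E c 2)⁻¹ * (t : borelAdelic F E c 2))).2 0 =
        diagUnit (((ρ s : torusInBorel F E c 2) : borelAdelic F E c 2)⁻¹).2 0 * diagUnit (t : borelAdelic F E c 2).2 0 := by
      refine Units.ext ?_
      rw [coe_diagUnit, Units.val_mul, coe_diagUnit, coe_diagUnit]
      change (adelicVal F E c 2 _ (((((ρ s : torusInBorel F E c 2) : borelAdelic F E c 2)⁻¹ : borelAdelic F E c 2) :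
          (quasiSplit F E c 2).Adelic) * ((t : borelAdelic F E c 2) : (quasiSplit F E c 2).Adelic)) :
            Matrix (Fin 2) (Fin 2) (AdeleRing (𝓞 E) E)) 0 0 = _
      rw [map_mul, Units.val_mul, adelicVal_eq_glDiagonal_diagUnit hinv, adelicVal_eq_glDiagonal_diagUnit (hSTt _ ht),
        coe_glDiagonal, coe_glDiagonal, Matrix.diagonal_mul_diagonal, Matrix.diagonal_apply_eq, Matrix.diagonal_apply_eq,
        Matrix.diagonal_apply_eq]
    have hdi : diagUnit (((ρ s : torusInBorel F E c 2) : borelAdelic F E c 2)⁻¹).2 0 = (diagUnit ((ρ s : torusInBorel F E c 2) :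
        borelAdelic F E c 2).2 0)⁻¹ := by
      rw [eq_inv_iff_mul_eq_one]
      have h1 : diagUnit ((((ρ s : torusInBorel F E c 2) : borelAdelic F E c 2)⁻¹ *
          ((ρ s : torusInBorel F E c 2) : borelAdelic F E c 2))).2 0 =
          diagUnit (((ρ s : torusInBorel F E c 2) : borelAdelic F E c 2)⁻¹).2 0 *
            diagUnit ((ρ s : torusInBorel F E c 2) : borelAdelic F E c 2).2 0 := by
        refine Units.ext ?_
        rw [coe_diagUnit, Units.val_mul, coe_diagUnit, coe_diagUnit]
        change (adelicVal F E c 2 _ (((((ρ s : torusInBorel F E c 2) : borelAdelic F E c 2)⁻¹ : borelAdelic F E c 2) :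
            (quasiSplit F E c 2).Adelic) * (((ρ s : torusInBorel F E c 2) : borelAdelic F E c 2) : (quasiSplit F E c 2).Adelic)) :
              Matrix (Fin 2) (Fin 2) (AdeleRing (𝓞 E) E)) 0 0 = _
        rw [map_mul, Units.val_mul, adelicVal_eq_glDiagonal_diagUnit hinv, adelicVal_eq_glDiagonal_diagUnit hρs,
          coe_glDiagonal, coe_glDiagonal, Matrix.diagonal_mul_diagonal, Matrix.diagonal_apply_eq, Matrix.diagonal_apply_eq,
          Matrix.diagonal_apply_eq]
      rw [← h1, inv_mul_cancel]
      refine Units.ext ?_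
      rw [coe_diagUnit]
      rfl
    rw [hmul, hd, hdi, hρd s, h0, mul_comm w, inv_mul_cancel_left]
    exact hw
  · -- every `T(F)`-orbit meets `S`
    intro t
    obtain ⟨τ, hτrat, hτt, hτS⟩ := hcov (t : borelAdelic F E c 2) ((mem_torusInBorel_iff_torusPart_eq _).1 t.2)
    refine ⟨⟨⟨τ, (mem_torusInBorel_iff_torusPart_eq τ).2 hτt⟩, Subgroup.mem_subgroupOf.2 (Subgroup.mem_comap.2 hτrat)⟩, ?_⟩
    rw [Subgroup.smul_def, smul_eq_mul]
    exact hτS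

/-! ## §5 The height window of the torus Siegel set of `U(J₂)` is compact -/

/-- **THE HEIGHT WINDOW OF THE TORUS SIEGEL SET OF `U(J₂)` IS COMPACT** (the `N = 2` sibling of ★ `isCompact_torusSiegel_heightWindow`): under the
polar export of ★ `exists_torusSiegelSet_two` (`d₀ t = w · z(eˢ)`, `w ∈ W` compact, `‖d₀ t‖ = e^{[E:ℚ]s}`, `H(t) = ‖d₀ t‖ · H(1)`) and for
`0 < H₀`, the set `{t ∈ T(𝔸_F) | ↑t ∈ S_T, H₀ ≤ H(t) ≤ R}` is compact: `H₀ ≤ e^{[E:ℚ]s} H(1) ≤ R` confines `s` to a compact interval, so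
`d₀ t ∈ W · z(e^{[s₀,s₁]})`, a compact window of `𝕀_E` (§2). [cite: Rogawski1990, §2.2 (p. 13)] [cite: Borel1963, §5] -/
theorem isCompact_torusSiegel_heightWindow_two (hc : c * c = 1) {S_T : Set (borelAdelic F E c 2)}
    {W : Set (AdeleRing (𝓞 E) E)ˣ} (hSc : IsClosed S_T) (hW : IsCompact W)
    (hexp : ∀ t ∈ S_T, ∃ w ∈ W, ∃ s : ℝ,
      diagUnit t.2 0 = w * posRealIdele E (expUnitNNReal s) ∧
      IdeleClassGroup.ideleNorm E (diagUnit t.2 0) = ((expUnitNNReal (Module.finrank ℚ E * s) : ℝ≥0ˣ) : ℝ≥0) ∧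
      borelHeight (t : (quasiSplit F E c 2).Adelic) =
        IdeleClassGroup.ideleNorm E (diagUnit t.2 0) * borelHeight (1 : (quasiSplit F E c 2).Adelic))
    {H₀ : ℝ≥0} (hH₀ : 0 < H₀) (R : ℝ≥0) :
    IsCompact {t : torusInBorel F E c 2 | (t : borelAdelic F E c 2) ∈ S_T ∧
      H₀ ≤ borelHeight ((t : borelAdelic F E c 2) : (quasiSplit F E c 2).Adelic) ∧
      borelHeight ((t : borelAdelic F E c 2) : (quasiSplit F E c 2).Adelic) ≤ R} := by
  -- constants: `n = [E:ℚ] > 0`, `H₁ = H(1) > 0`, the `s`-interval `[s₀, s₁]`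
  set n : ℝ := (Module.finrank ℚ E : ℝ) with hn
  have hn0 : 0 < n := by
    rw [hn]
    exact_mod_cast Module.finrank_pos
  set H₁ : ℝ := ((borelHeight (1 : (quasiSplit F E c 2).Adelic) : ℝ≥0) : ℝ) with hH₁
  have hH₁0 : 0 < H₁ := by
    rw [hH₁]
    exact_mod_cast borelHeight_pos (1 : (quasiSplit F E c 2).Adelic)
  have hH₀0 : 0 < ((H₀ : ℝ≥0) : ℝ) := by exact_mod_cast hH₀
  set s₀ : ℝ := Real.log ((H₀ : ℝ) / H₁) / n with hs₀
  set s₁ : ℝ := Real.log ((R : ℝ) / H₁) / n with hs₁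
  -- the compact window of `𝕀_E` and the closed window of heights
  set Ray : Set (AdeleRing (𝓞 E) E)ˣ := (fun s : ℝ => posRealIdele E (expUnitNNReal s)) '' Icc s₀ s₁ with hRay
  have hRayc : IsCompact Ray := isCompact_Icc.image ((continuous_posRealIdele E).comp continuous_expUnitNNReal)
  have hK := isCompact_setOf_diagUnit_zero_mem_two (F := F) (E := E) (c := c) hc (hW.mul hRayc)
  have hH : Continuous fun t : torusInBorel F E c 2 =>
      borelHeight ((t : borelAdelic F E c 2) : (quasiSplit F E c 2).Adelic) :=
    continuous_borelHeight.comp (continuous_subtype_val.comp continuous_subtype_val)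
  have hclosed : IsClosed {t : torusInBorel F E c 2 | (t : borelAdelic F E c 2) ∈ S_T ∧
      H₀ ≤ borelHeight ((t : borelAdelic F E c 2) : (quasiSplit F E c 2).Adelic) ∧
      borelHeight ((t : borelAdelic F E c 2) : (quasiSplit F E c 2).Adelic) ≤ R} := by
    rw [Set.setOf_and, Set.setOf_and]
    exact (hSc.preimage continuous_subtype_val).inter
      ((isClosed_le continuous_const hH).inter (isClosed_le hH continuous_const))
  refine hK.of_isClosed_subset hclosed ?_
  rintro t ⟨ht, hlow, hup⟩
  obtain ⟨w, hwW, s, hd0, hnorm, hHt⟩ := hexp (t : borelAdelic F E c 2) ht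
  -- the height of `t` as a real number: `H(t) = e^{n s} · H₁`
  have hHreal : ((borelHeight ((t : borelAdelic F E c 2) : (quasiSplit F E c 2).Adelic) : ℝ≥0) : ℝ) =
      Real.exp (n * s) * H₁ := by
    rw [hHt, hnorm, NNReal.coe_mul, coe_expUnitNNReal]
  have hlow' : ((H₀ : ℝ≥0) : ℝ) ≤ Real.exp (n * s) * H₁ := by
    rw [← hHreal]; exact_mod_cast hlow
  have hup' : Real.exp (n * s) * H₁ ≤ ((R : ℝ≥0) : ℝ) := by
    rw [← hHreal]; exact_mod_cast hup
  -- hence `s ∈ [s₀, s₁]`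
  have hs : s ∈ Icc s₀ s₁ := by
    constructor
    · have h1 : (H₀ : ℝ) / H₁ ≤ Real.exp (n * s) := (div_le_iff₀ hH₁0).2 hlow'
      have h2 : Real.log ((H₀ : ℝ) / H₁) ≤ n * s := (Real.log_le_iff_le_exp (div_pos hH₀0 hH₁0)).2 h1
      rw [hs₀]
      exact (div_le_iff₀' hn0).2 h2
    · have hR0 : 0 < ((R : ℝ≥0) : ℝ) := lt_of_lt_of_le (mul_pos (Real.exp_pos _) hH₁0) hup'
      have h1 : Real.exp (n * s) ≤ (R : ℝ) / H₁ := (le_div_iff₀ hH₁0).2 hup'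
      have h2 : n * s ≤ Real.log ((R : ℝ) / H₁) := (Real.le_log_iff_exp_le (div_pos hR0 hH₁0)).2 h1
      rw [hs₁]
      exact (le_div_iff₀' hn0).2 h2
  show diagUnit (t : borelAdelic F E c 2).2 0 ∈ W * Ray
  rw [hd0]
  exact Set.mul_mem_mul hwW ⟨s, hs, rfl⟩

/-- **The height window has finite measure** for every measure on `T(𝔸_F)` finite on compacts (e.g. a Haar measure `μ_T`).
[cite: Rogawski1990, §2.2 (p. 13)] [cite: Arthur1978TraceFormulaI, §8 (pp. 947–950)] -/
theorem measure_torusSiegel_heightWindow_two_lt_top (hc : c * c = 1) [MeasurableSpace (torusInBorel F E c 2)]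
    (μT : Measure (torusInBorel F E c 2)) [IsFiniteMeasureOnCompacts μT] {S_T : Set (borelAdelic F E c 2)}
    {W : Set (AdeleRing (𝓞 E) E)ˣ} (hSc : IsClosed S_T) (hW : IsCompact W)
    (hexp : ∀ t ∈ S_T, ∃ w ∈ W, ∃ s : ℝ,
      diagUnit t.2 0 = w * posRealIdele E (expUnitNNReal s) ∧
      IdeleClassGroup.ideleNorm E (diagUnit t.2 0) = ((expUnitNNReal (Module.finrank ℚ E * s) : ℝ≥0ˣ) : ℝ≥0) ∧
      borelHeight (t : (quasiSplit F E c 2).Adelic) =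
        IdeleClassGroup.ideleNorm E (diagUnit t.2 0) * borelHeight (1 : (quasiSplit F E c 2).Adelic))
    {H₀ : ℝ≥0} (hH₀ : 0 < H₀) (R : ℝ≥0) :
    μT {t : torusInBorel F E c 2 | (t : borelAdelic F E c 2) ∈ S_T ∧
      H₀ ≤ borelHeight ((t : borelAdelic F E c 2) : (quasiSplit F E c 2).Adelic) ∧
      borelHeight ((t : borelAdelic F E c 2) : (quasiSplit F E c 2).Adelic) ≤ R} < ⊤ :=
  (isCompact_torusSiegel_heightWindow_two hc hSc hW hexp hH₀ R).measure_lt_top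

end UnitaryGroup

end Literature.NumberTheory.Automorphic

end
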